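import Mathlib
import Literature.NumberTheory.Sieve.HeathBrownMorozResidueClasses
import Literature.NumberTheory.Sieve.HeathBrownCubicTypeII
import Summits.Parity.GeneralizedHardyLittlewood.Theses.GoldbachHeathBrownDispersion

/-!
# Sketch — first lemmas for the crux ideas on `HeathBrownMorozUniform` (stmt-Parity-19915)

Card A (`upset-exponent-bookkeeping`): `PrimePairCountUpset` (d = 1 rung), `PrimePairCountBand`,
`ResidueClassUpset`, `ClassShift`, `UpsetSuffices`.
Card B (`character-twist-typeII`): `twistedBilin`, `TwistBlindTypeII`, `classPairs`, `ClassTypeII`,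
`TwistReduces`.
Nothing here is proved; these are the checkable signatures the idea cards refer to.
-/

noncomputable section

open Filter Asymptotics Finset NumberField
open scoped Topology

namespace Summit.Parity.GeneralizedHardyLittlewood.Cruxes.HeathBrownMorozUniform.Ideas

open Literature.NumberTheory.Sieve.CubicPrimes
open Literature.NumberTheory.Sieve.CubicSieve
open Literature.NumberTheory.LFunctions.CubeRootTwoField

/-! ## Card A — admissible box exponents form an up-set -/

/-- **d = 1 rung.** Heath-Brown's theorem for EVERY box exponent `c ≥ c₀`: what (3.15) of
[HeathBrownActa2001, p. 18] gives, since every constraint on the exponent of `η` in the bookkeeping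
(tree: `HeathBrown2001_typeII_terms_of`, `cη := 2 cs + 6`, `A := 160 (2 cη + cs + 4)`) is a LOWER bound. -/
def PrimePairCountUpset : Prop :=
  ∃ c₀ : ℝ, 0 < c₀ ∧ ∃ σ₀ : ℝ, 0 < σ₀ ∧ Tendsto singularProductPartial atTop (𝓝 σ₀) ∧
    ∀ c : ℝ, c₀ ≤ c →
      (fun X : ℝ => (primePairCount X (Real.log X ^ (-c)) : ℝ) - mainTerm c σ₀ X) =o[atTop]
        fun X : ℝ => mainTerm c σ₀ X

/-- **Band form** of the d = 1 rung: any box-size function `η(X)` squeezed between two admissible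
powers of `log X` (kills every "sliver" comparison downstream, e.g. `η' = (log (X/d))^{-c}`). -/
def PrimePairCountBand : Prop :=
  ∃ c₀ : ℝ, 0 < c₀ ∧ ∃ σ₀ : ℝ, 0 < σ₀ ∧ Tendsto singularProductPartial atTop (𝓝 σ₀) ∧
    ∀ c₁ : ℝ, c₀ ≤ c₁ → ∀ η : ℝ → ℝ,
      (∀ᶠ X in atTop, Real.log X ^ (-c₁) ≤ η X ∧ η X ≤ Real.log X ^ (-c₀)) →
        (fun X : ℝ => (primePairCount X (η X) : ℝ) - σ₀ * η X ^ 2 * X ^ 2 / (3 * Real.log X))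
          =o[atTop] fun X : ℝ => η X ^ 2 * X ^ 2 / Real.log X

/-- **Per-class up-set** (Heath-Brown–Moroz 2004 Thm 2 for `x³+2y³`, class by class, every
`c ≥ c₀(d,a,b)`): the target of the class bookkeeping theorem fed by the η-uniform class facts
(HBM04 Prop. 4.1 and Prop. 4.2 typed over Heath-Brown's range (2.1)). -/
def ResidueClassUpset : Prop :=
  ∀ d a b : ℕ, 0 < d → Nat.Coprime (a ^ 3 + 2 * b ^ 3) d →
    ∃ c₀ : ℝ, 0 < c₀ ∧ ∃ σ₀ : ℝ, 0 < σ₀ ∧ Tendsto singularProductPartial atTop (𝓝 σ₀) ∧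
      ∀ c : ℝ, c₀ ≤ c →
        (fun X : ℝ => (residueClassPrimeCount X (Real.log X ^ (-c)) d a b : ℝ) -
            classWeight d * mainTerm c σ₀ X) =o[atTop] fun X : ℝ => mainTerm c σ₀ X

/-- **Shift lemma** (support, elementary): unreduced representatives `(a + ds, b + dt)` change the
class count by `O(ηX) = o(main term)` (two slivers of `≤ (s+t+2)(ηX+2)` lattice points). -/
def ClassShift : Prop :=
  ∀ d a b s t : ℕ, 0 < d → ∀ c : ℝ, 0 < c →
    (fun X : ℝ => (residueClassPrimeCount X (Real.log X ^ (-c)) d (a + d * s) (b + d * t) : ℝ) -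
        residueClassPrimeCount X (Real.log X ^ (-c)) d a b) =o[atTop] fun X : ℝ => mainTerm c 1 X

/-- **Finite max.** The per-class up-set implies the crux: for each `Q`, take
`c_Q = max {c₀(d, a mod d, b mod d) : d ≤ Q, class admissible}` (finitely many) and `ClassShift`. -/
def UpsetSuffices : Prop :=
  ResidueClassUpset →
    Summit.Parity.GeneralizedHardyLittlewood.Theses.GoldbachHeathBrownDispersion.HeathBrownMorozUniform

/-! ## Card B — Heath-Brown's Type II bound is blind to multiplicative twists mod `d` -/

/-- The ideal `(d) ⊆ 𝓞_K`, `K = ℚ(2^{1/3})`. -/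
def dIdeal (d : ℕ) : Ideal (𝓞 K) := Ideal.span ({((d : ℕ) : 𝓞 K)} : Set (𝓞 K))

/-- **Character-twisted bilinear sum (3.3)**: `∑_{(x,y) ∈ box} ψ(x + y·2^{1/3} mod d) ∑_{RS = (x+y2^{1/3})} c_R f_S`
for a multiplicative character `ψ` of `𝓞_K/(d)` (the class of the MEMBER is twisted, not the factors:
inside the proof `ψ(αβ) = ψ(α)ψ(β)` is absorbed into the two weights, `|c_R ψ(α)| ≤ 1` dies in
Cauchy–Schwarz over `α` (tree: `abs_mainMV_le`), `f_S ψ(β)` keeps (3.14) at level `d·Q₁`). -/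
def twistedBilin (X η : ℝ) (d : ℕ) (ψ : MulChar ((𝓞 K) ⧸ dIdeal d) ℂ)
    (c f : Ideal (𝓞 K) → ℝ) : ℂ :=
  ∑ xy ∈ boxPairs X η,
    ψ (Ideal.Quotient.mk (dIdeal d) (pairElt xy)) *
      ((∑ RS ∈ divisorPairs (pairIdeal xy), c RS.1 * f RS.2 : ℝ) : ℂ)

/-- **Twist-blind Lemma 3.10** (first lemma of card B): Heath-Brown's Type II bound
[HeathBrownActa2001, Lemma 3.10] with the member twisted by any character `ψ` of `(𝓞_K/(d))^×`,
at the cost of hypothesis (3.14) up to `d·Q₁` (supplied by Lemma 3.8 for every power of `log X`) and a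
factor `d^c`; same quantifier shape as the tree's `HeathBrown2001_lemma_3_10`. -/
def TwistBlindTypeII : Prop :=
  ∀ ϖ : ℝ, 0 < ϖ → ϖ < 1 / 5 →
    ∃ c c₃ c₄ : ℝ, 0 < c₃ ∧ 0 < c₄ ∧ ∀ C₁ c₁ c₅ c₆ : ℝ, 0 < c₁ → 0 < c₅ → 0 < c₆ →
      ∃ C X₀ : ℝ, ∀ X η Q₁ : ℝ, X₀ ≤ X → Real.exp (-Real.log X ^ (1 / 3 : ℝ)) ≤ η → η ≤ 1 →
        1 ≤ Q₁ → ∀ d : ℕ, 1 ≤ d → (d : ℝ) * Q₁ ≤ Real.exp (Real.log X ^ (1 / 3 : ℝ)) →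
          (∀ (k' : ℕ) (m' : Fin k' → ℕ), CoreAdmissible (hbTau ϖ X) m' →
            Hyp314 X (hbTau ϖ X) m' ((d : ℝ) * Q₁) C₁ c₁ c₃ c₄) →
            ∀ ψ : MulChar ((𝓞 K) ⧸ dIdeal d) ℂ,
              ∀ (k : ℕ) (m : Fin k → ℕ), CoreAdmissible (hbTau ϖ X) m →
                ∀ cR : Ideal (𝓞 K) → ℝ, CSupport X (hbTau ϖ X) cR →
                  ∀ V : ℝ, c₅ * X ^ (1 + hbTau ϖ X) ≤ V → V ≤ c₆ * X ^ (3 / 2 - hbTau ϖ X) →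
                    ‖twistedBilin X η d ψ cR
                        (fun S => if V < (Ideal.absNorm S : ℝ) ∧ (Ideal.absNorm S : ℝ) ≤ 2 * V then
                          fWeight X (hbTau ϖ X) m S else 0)‖ ≤
                      C * (d : ℝ) ^ c * X ^ 2 * Q₁ ^ (-(1 / 160 : ℝ)) * Real.log X ^ c

/-- The members of `𝒜^(K)` in the class `(a, b) mod d` (filter of Heath-Brown's square box; the
`O(d)` corner shift to the class box of `residueClassPrimeCount` is `ClassShift`-negligible). -/
def classPairs (X η : ℝ) (d a b : ℕ) : Finset (ℕ × ℕ) :=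
  {xy ∈ boxPairs X η | xy.1 ≡ a [MOD d] ∧ xy.2 ≡ b [MOD d]}

/-- **Class Type II** = Heath-Brown–Moroz 2004 Prop. 4.2 (ii) for `x³+2y³` in tree language: the
f-part bilinear sum restricted to a class, «the only assertion that needs a new proof» (HBM04 p. 21). -/
def ClassTypeII : Prop :=
  ∀ ϖ : ℝ, 0 < ϖ → ϖ < 1 / 5 →
    ∃ c c₃ c₄ : ℝ, 0 < c₃ ∧ 0 < c₄ ∧ ∀ C₁ c₁ c₅ c₆ : ℝ, 0 < c₁ → 0 < c₅ → 0 < c₆ →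
      ∃ C X₀ : ℝ, ∀ X η Q₁ : ℝ, X₀ ≤ X → Real.exp (-Real.log X ^ (1 / 3 : ℝ)) ≤ η → η ≤ 1 →
        1 ≤ Q₁ → ∀ d : ℕ, 1 ≤ d → (d : ℝ) * Q₁ ≤ Real.exp (Real.log X ^ (1 / 3 : ℝ)) →
          (∀ (k' : ℕ) (m' : Fin k' → ℕ), CoreAdmissible (hbTau ϖ X) m' →
            Hyp314 X (hbTau ϖ X) m' ((d : ℝ) * Q₁) C₁ c₁ c₃ c₄) →
            ∀ a b : ℕ, Nat.Coprime (a ^ 3 + 2 * b ^ 3) d →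
              ∀ (k : ℕ) (m : Fin k → ℕ), CoreAdmissible (hbTau ϖ X) m →
                ∀ cR : Ideal (𝓞 K) → ℝ, CSupport X (hbTau ϖ X) cR →
                  ∀ V : ℝ, c₅ * X ^ (1 + hbTau ϖ X) ≤ V → V ≤ c₆ * X ^ (3 / 2 - hbTau ϖ X) →
                    |bilin (classPairs X η d a b) pairIdeal cR
                        (fun S => if V < (Ideal.absNorm S : ℝ) ∧ (Ideal.absNorm S : ℝ) ≤ 2 * V then
                          fWeight X (hbTau ϖ X) m S else 0)| ≤
                      C * (d : ℝ) ^ c * X ^ 2 * Q₁ ^ (-(1 / 160 : ℝ)) * Real.log X ^ c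

/-- Orthogonality of characters of the finite group `(𝓞_K/(d))^×` turns the twist-blind bound into
the class bound (the class `a + b·2^{1/3}` is a unit mod `d` by admissibility; non-unit members are
killed by every `ψ`, consistently on both sides). -/
def TwistReduces : Prop := TwistBlindTypeII → ClassTypeII

end Summit.Parity.GeneralizedHardyLittlewood.Cruxes.HeathBrownMorozUniform.Ideas

end
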